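import Summits.Ventures.QEC.Census.CNFEncodeCounter
import HarnessLib

/-!
# `enc-v1` encoder: ENCODING SOUNDNESS (`cnfEncode_unsat_imp`, `cnfEncodeAny_unsat_imp`, leaf form)

Cell `qec`, PARTITION v2 row type-11 — the K2 ENCODING obligation (director-qec D1 (ii)): a solution of
the distance question `Q(H,u,w)` / `Q_any(H,U,w)` extends to a model of the Lean-generated CNF, hence an
(LRAT-certified) UNSAT verdict on that CNF excludes every solution.  `cnfEncodeAny_append_unsat_imp` is the
shape of the pinned/cubed `enc-v2` leaves (base CNF ++ unit/cube clauses on coordinate variables).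
-/

namespace Summit.Ventures.QEC.Census.CNFEncode

open Std.Sat

/-- `CNF.Sat` of a list-built formula is clause-wise truth. -/
theorem sat_mk_iff (a : ℕ → Bool) (cs : List Clause) :
    (⟨cs.toArray⟩ : CNF Nat).Sat a ↔ ∀ c ∈ cs, CNF.Clause.eval a c = true := by
  simp [CNF.Sat, CNF.eval, List.all_eq_true]

/-- **Encoding soundness for `Q(H,u,w)`** (completeness of `enc-v1`): a solution of the question
extends — changing only auxiliary variables `≥ n` — to a model of `cnfEncode n rows u w`. -/
theorem cnfEncode_sat_of_solves {n : ℕ} {rows : List (List ℕ)} {u : List ℕ} {w : ℕ} {a : ℕ → Bool}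
    (hrows : ∀ r ∈ rows, ∀ i ∈ r, i < n) (hu : ∀ i ∈ u, i < n) (h : Solves n rows u w a) :
    ∃ a' : ℕ → Bool, (∀ i < n, a' i = a i) ∧ (cnfEncode n rows u w).Sat a' := by
  obtain ⟨hre, huo, hwl⟩ := h
  obtain ⟨a1, ha1_old, ha1_sat⟩ := encRows_sound a n rows hrows hre
  obtain ⟨hv1, hv1'⟩ := encRows_vars n rows hrows
  have hu1 : ∀ i ∈ u, i < (encRows n rows).2 := fun i hi => lt_of_lt_of_le (hu i hi) hv1
  have hpar1 : lparity a1 u = true := by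
    rw [lparity_congr u (fun x hx => ha1_old x (hu x hx))]; exact huo
  obtain ⟨a2, ha2_old, ha2_sat⟩ := xorChain_sound a1 u.length _ u true hu1 hpar1
  obtain ⟨hv2, hv2'⟩ := xorChain_vars u.length (encRows n rows).2 u true hu1
  have hn2 : n ≤ (xorChain u.length (encRows n rows).2 u true).2 := le_trans hv1 hv2
  have hwt2 : weight a2 n ≤ w := by
    have : weight a2 n = weight a n := by
      simp only [weight]
      apply List.countP_congr
      intro k hk
      rw [List.mem_range] at hk
      rw [ha2_old k (by omega), ha1_old k hk]
    rw [this]; exact hwl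
  obtain ⟨a3, ha3_old, ha3_sat⟩ := atMost_sound a2 n w _ hn2 hwt2
  refine ⟨a3, fun i hi => by rw [ha3_old i (by omega), ha2_old i (by omega), ha1_old i hi], ?_⟩
  simp only [cnfEncode]
  rw [sat_mk_iff]
  intro c hc
  simp only [List.mem_append] at hc
  rcases hc with (hc | hc) | hc
  · rw [clause_eval_congr c (b := a1) (fun l hl => ?_)]
    · exact ha1_sat c hc
    · rw [ha3_old _ (lt_of_lt_of_le (hv1' c hc l hl) hv2), ha2_old _ (hv1' c hc l hl)]
  · rw [clause_eval_congr c (b := a2) (fun l hl => ha3_old _ (hv2' c hc l hl))]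
    exact ha2_sat c hc
  · exact ha3_sat c hc

/-- **`cnfEncode_unsat_imp`** (PARTITION v2 row type-11): if the `enc-v1` CNF is unsatisfiable then
the question `Q(H,u,w)` has no solution — there is no `v ∈ 𝔽₂ⁿ` with all row parities even, `⟨u,v⟩ = 1`
and `wt v ≤ w`. -/
theorem cnfEncode_unsat_imp {n : ℕ} {rows : List (List ℕ)} {u : List ℕ} {w : ℕ}
    (hrows : ∀ r ∈ rows, ∀ i ∈ r, i < n) (hu : ∀ i ∈ u, i < n)
    (h : (cnfEncode n rows u w).Unsat) : ¬ ∃ a, Solves n rows u w a := by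
  rintro ⟨a, ha⟩
  obtain ⟨a', -, hsat⟩ := cnfEncode_sat_of_solves hrows hu ha
  have := h a'
  rw [CNF.Sat] at hsat
  rw [hsat] at this
  exact Bool.noConfusion this

/-- Variables and soundness of block (2′). -/
theorem encLogicals_vars (nv : ℕ) (us : List (List ℕ)) (h : ∀ u ∈ us, ∀ x ∈ u, x < nv) :
    nv ≤ (encLogicals nv us).2.1 ∧
      (∀ c ∈ (encLogicals nv us).1, ∀ l ∈ c, l.1 < (encLogicals nv us).2.1) ∧
      ∀ t ∈ (encLogicals nv us).2.2, t < (encLogicals nv us).2.1 := by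
  induction us generalizing nv with
  | nil => simp [encLogicals]
  | cons u us ih =>
    simp only [encLogicals]
    have hux : ∀ x ∈ u ++ [nv], x < nv + 1 := by
      intro x hx
      simp only [List.mem_append, List.mem_singleton] at hx
      rcases hx with hx | rfl
      · have := h u (by simp) x hx; omega
      · omega
    obtain ⟨h1, h2⟩ := xorChain_vars (u.length + 1) (nv + 1) (u ++ [nv]) false hux
    obtain ⟨h3, h4, h5⟩ := ih (xorChain (u.length + 1) (nv + 1) (u ++ [nv]) false).2
      (fun u' hu' x hx => by have := h u' (by simp [hu']) x hx; omega)
    refine ⟨by omega, fun c hc l hl => ?_, fun t ht => ?_⟩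
    · simp only [List.mem_append] at hc
      rcases hc with hc | hc
      · exact lt_of_lt_of_le (h2 c hc l hl) h3
      · exact h4 c hc l hl
    · simp only [List.mem_cons] at ht
      rcases ht with rfl | ht
      · omega
      · exact h5 t ht

/-- Block (2′) is complete, with `t_j := ⟨u_j, a⟩`: if some `u_j` is odd under `a` then some
indicator is `true` in the model. -/
theorem encLogicals_sound (a : ℕ → Bool) (nv : ℕ) (us : List (List ℕ))
    (h : ∀ u ∈ us, ∀ x ∈ u, x < nv) :
    ∃ a' : ℕ → Bool, (∀ y < nv, a' y = a y) ∧
      (∀ c ∈ (encLogicals nv us).1, CNF.Clause.eval a' c = true) ∧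
      ((∃ u ∈ us, lparity a u = true) → ∃ t ∈ (encLogicals nv us).2.2, a' t = true) := by
  induction us generalizing nv a with
  | nil => exact ⟨a, fun _ _ => rfl, by simp [encLogicals], by simp⟩
  | cons u us ih =>
    simp only [encLogicals]
    let a0 : ℕ → Bool := fun v => if v = nv then lparity a u else a v
    have ha0_old : ∀ y < nv, a0 y = a y := by intro y hy; simp only [a0]; rw [if_neg (by omega)]
    have ha0_nv : a0 nv = lparity a u := by simp [a0]
    have hu_lt : ∀ x ∈ u, x < nv := h u (by simp)
    have hux : ∀ x ∈ u ++ [nv], x < nv + 1 := by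
      intro x hx
      simp only [List.mem_append, List.mem_singleton] at hx
      rcases hx with hx | rfl
      · have := hu_lt x hx; omega
      · omega
    have hpar0 : lparity a0 (u ++ [nv]) = false := by
      rw [lparity_append, lparity_congr u (fun x hx => ha0_old x (hu_lt x hx))]
      simp [lparity, ha0_nv]
    obtain ⟨a1, ha1_old, ha1_sat⟩ :=
      xorChain_sound a0 (u.length + 1) (nv + 1) (u ++ [nv]) false hux hpar0
    obtain ⟨hv1, hv1'⟩ := xorChain_vars (u.length + 1) (nv + 1) (u ++ [nv]) false hux
    have h' : ∀ u' ∈ us, ∀ x ∈ u', x < (xorChain (u.length + 1) (nv + 1) (u ++ [nv]) false).2 :=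
      fun u' hu' x hx => by have := h u' (by simp [hu']) x hx; omega
    obtain ⟨a2, ha2_old, ha2_sat, ha2_t⟩ := ih a1 _ h'
    refine ⟨a2, fun y hy => by rw [ha2_old y (by omega), ha1_old y (by omega), ha0_old y hy],
      fun c hc => ?_, fun hex => ?_⟩
    · simp only [List.mem_append] at hc
      rcases hc with hc | hc
      · rw [clause_eval_congr c (b := a1) (fun l hl => ha2_old _ (hv1' c hc l hl))]
        exact ha1_sat c hc
      · exact ha2_sat c hc
    · obtain ⟨u', hu', hodd⟩ := hex
      simp only [List.mem_cons] at hu'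
      by_cases hu0 : lparity a u = true
      · refine ⟨nv, by simp, ?_⟩
        rw [ha2_old nv (by omega), ha1_old nv (by omega), ha0_nv, hu0]
      · rcases hu' with rfl | hu'
        · exact absurd hodd hu0
        · have hodd1 : lparity a1 u' = true := by
            rw [lparity_congr u' (fun x hx => ?_), hodd]
            have hx' := h u' (by simp [hu']) x hx
            rw [ha1_old x (by omega), ha0_old x hx']
          obtain ⟨t, ht, hat⟩ := ha2_t ⟨u', hu', hodd1⟩
          exact ⟨t, by simp [ht], hat⟩

/-- **Encoding soundness for `Q_any(H,U,w)`**: a solution extends to a model of `cnfEncodeAny`. -/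
theorem cnfEncodeAny_sat_of_solves {n : ℕ} {rows : List (List ℕ)} {us : List (List ℕ)} {w : ℕ}
    {a : ℕ → Bool} (hrows : ∀ r ∈ rows, ∀ i ∈ r, i < n) (hus : ∀ u ∈ us, ∀ i ∈ u, i < n)
    (h : SolvesAny n rows us w a) :
    ∃ a' : ℕ → Bool, (∀ i < n, a' i = a i) ∧ (cnfEncodeAny n rows us w).Sat a' := by
  obtain ⟨hre, hso, hwl⟩ := h
  obtain ⟨a1, ha1_old, ha1_sat⟩ := encRows_sound a n rows hrows hre
  obtain ⟨hv1, hv1'⟩ := encRows_vars n rows hrows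
  have hus1 : ∀ u ∈ us, ∀ i ∈ u, i < (encRows n rows).2 :=
    fun u hu i hi => lt_of_lt_of_le (hus u hu i hi) hv1
  have hso1 : ∃ u ∈ us, lparity a1 u = true := by
    obtain ⟨u, hu, hodd⟩ := hso
    exact ⟨u, hu, by rw [lparity_congr u (fun x hx => ha1_old x (hus u hu x hx)), hodd]⟩
  obtain ⟨a2, ha2_old, ha2_sat, ha2_t⟩ := encLogicals_sound a1 _ us hus1
  obtain ⟨hv2, hv2', hv2t⟩ := encLogicals_vars (encRows n rows).2 us hus1
  have hn2 : n ≤ (encLogicals (encRows n rows).2 us).2.1 := le_trans hv1 hv2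
  have hwt2 : weight a2 n ≤ w := by
    have : weight a2 n = weight a n := by
      simp only [weight]
      apply List.countP_congr
      intro k hk
      rw [List.mem_range] at hk
      rw [ha2_old k (by omega), ha1_old k hk]
    rw [this]; exact hwl
  obtain ⟨a3, ha3_old, ha3_sat⟩ := atMost_sound a2 n w _ hn2 hwt2
  refine ⟨a3, fun i hi => by rw [ha3_old i (by omega), ha2_old i (by omega), ha1_old i hi], ?_⟩
  simp only [cnfEncodeAny]
  rw [sat_mk_iff]
  intro c hc
  simp only [List.mem_append, List.mem_singleton] at hc
  rcases hc with ((hc | hc) | rfl) | hc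
  · rw [clause_eval_congr c (b := a1) (fun l hl => ?_)]
    · exact ha1_sat c hc
    · rw [ha3_old _ (lt_of_lt_of_le (hv1' c hc l hl) hv2), ha2_old _ (hv1' c hc l hl)]
  · rw [clause_eval_congr c (b := a2) (fun l hl => ha3_old _ (hv2' c hc l hl))]
    exact ha2_sat c hc
  · -- the clause `t_1 ∨ ⋯ ∨ t_k`
    obtain ⟨t, ht, hat⟩ := ha2_t hso1
    simp only [CNF.Clause.eval, List.any_eq_true, List.mem_map]
    refine ⟨(t, true), ⟨t, ht, rfl⟩, ?_⟩
    simp [ha3_old t (hv2t t ht), hat]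
  · exact ha3_sat c hc

/-- **`cnfEncodeAny_unsat_imp`**: if the `Q_any` CNF is unsatisfiable, no `v` has all rows even, some
`⟨u_j,v⟩ = 1`, and `wt v ≤ w`. -/
theorem cnfEncodeAny_unsat_imp {n : ℕ} {rows : List (List ℕ)} {us : List (List ℕ)} {w : ℕ}
    (hrows : ∀ r ∈ rows, ∀ i ∈ r, i < n) (hus : ∀ u ∈ us, ∀ i ∈ u, i < n)
    (h : (cnfEncodeAny n rows us w).Unsat) : ¬ ∃ a, SolvesAny n rows us w a := by
  rintro ⟨a, ha⟩
  obtain ⟨a', -, hsat⟩ := cnfEncodeAny_sat_of_solves hrows hus ha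
  have := h a'
  rw [CNF.Sat] at hsat
  rw [hsat] at this
  exact Bool.noConfusion this

/-! ## Appending clauses on coordinate variables (pinned / cube leaves of `enc-v2`) -/

/-- If the extra clauses mention only coordinate variables `< n` and hold for the solution itself, the
base CNF with the extra clauses appended is still satisfiable — the shape of the `enc-v2` leaves
(case units and cube literals are coordinate literals). -/
theorem cnfEncodeAny_append_sat_of_solves {n : ℕ} {rows : List (List ℕ)} {us : List (List ℕ)}
    {w : ℕ} {a : ℕ → Bool} (extra : List Clause) (hrows : ∀ r ∈ rows, ∀ i ∈ r, i < n)
    (hus : ∀ u ∈ us, ∀ i ∈ u, i < n) (hextra : ∀ c ∈ extra, ∀ l ∈ c, l.1 < n)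
    (hsat : ∀ c ∈ extra, CNF.Clause.eval a c = true) (h : SolvesAny n rows us w a) :
    ∃ a' : ℕ → Bool, (∀ i < n, a' i = a i) ∧
      ((cnfEncodeAny n rows us w) ++ (⟨extra.toArray⟩ : CNF Nat)).Sat a' := by
  obtain ⟨a', ha', hs⟩ := cnfEncodeAny_sat_of_solves hrows hus h
  refine ⟨a', ha', ?_⟩
  rw [CNF.Sat] at hs ⊢
  rw [CNF.eval_append, hs, Bool.true_and]
  have : (⟨extra.toArray⟩ : CNF Nat).Sat a' := by
    rw [sat_mk_iff]
    intro c hc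
    rw [clause_eval_congr c (b := a) (fun l hl => ha' _ (hextra c hc l hl))]
    exact hsat c hc
  exact this

/-- Unsatisfiability of a leaf (base `Q_any` CNF with coordinate clauses appended) excludes every
solution that satisfies the appended clauses. -/
theorem cnfEncodeAny_append_unsat_imp {n : ℕ} {rows : List (List ℕ)} {us : List (List ℕ)}
    {w : ℕ} (extra : List Clause) (hrows : ∀ r ∈ rows, ∀ i ∈ r, i < n)
    (hus : ∀ u ∈ us, ∀ i ∈ u, i < n) (hextra : ∀ c ∈ extra, ∀ l ∈ c, l.1 < n)
    (h : ((cnfEncodeAny n rows us w) ++ (⟨extra.toArray⟩ : CNF Nat)).Unsat) :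
    ∀ a, (∀ c ∈ extra, CNF.Clause.eval a c = true) → ¬ SolvesAny n rows us w a := by
  intro a hsat ha
  obtain ⟨a', -, hs⟩ := cnfEncodeAny_append_sat_of_solves extra hrows hus hextra hsat ha
  have := h a'
  rw [CNF.Sat] at hs
  rw [hs] at this
  exact Bool.noConfusion this

end Summit.Ventures.QEC.Census.CNFEncode
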